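import Summits.AtomisticToContinuum.Crystallization.Theorems.HullExactificationCascadeRobustBarlowTemplateTransportSteps1
import Summits.AtomisticToContinuum.Crystallization.Theorems.HullExactificationCascadeRobustBarlowTemplateTransportSteps6
import Summits.AtomisticToContinuum.Crystallization.Theorems.HullExactificationCascadeRobustBarlowTemplateTransportSteps7
import Summits.AtomisticToContinuum.Crystallization.Theorems.HullExactificationCascadeRobustBarlowTemplateTransportLower
import Summits.AtomisticToContinuum.Crystallization.Theorems.PalmUnimodularRigidityShellsToBarlowChartTransportVinv

/-!
# Line `registered` (crux `RobustBarlowTemplate`, stmt-AtomisticToContinuum-12088): the downward transport `V⁻¹` (specification)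

Helper lemmas for `develop_transport` (the geometric half of the line): frames `⟨x, t₁, t₂, U⟩`
read in the scale-relative integer charts `IsZChart` of an everywhere-good configuration with
reciprocal shells, their transports and the coherence of the resulting development `frameAt`.
The only metric inputs are the chart transfer lemma (`develop_transfer`, through
`transfer_nb_nb` / `transfer_nb_centre` of part 1) and `bond_nb_iff`; everything else is label
combinatorics in `ℤ³` (pattern facts `PalmUnimodularRigidityShellsToBarlowChartTransportPatterns*`
of the closed sibling crux `ShellsToBarlowChart`, stmt-9227, imported verbatim).  All `[folklore]`
(HalesDSP2012 §1.3 for the two kissing patterns).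

## Port notes
This file is the port of `PalmUnimodularRigidityShellsToBarlowChartTransportVinv.lean`
(stmt-9227) to the SHELL relation of this crux, following verbatim the rules recorded in part 1
(`…RobustBarlowTemplateTransportSteps1`, "Port notes") and the extended `open … hiding …` line of
part 6:
* charts are `hch : ∀ z ∈ S, IsZChart S z (Pc z) (Ac z) (nb z)` (no scale family `ac`);
* the bond window `0 < dist a b ∧ dist a b ≤ 28/25` is replaced throughout by `b ∈ shell S a`
  (in the statement of `VinvStep_spec`: the conjunct
  `nb x (apexOf t₁ t₂ (lowerCap (Pc x) t₁ t₂ U)) ∈ shell S x` at the position of the bond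
  conjunct of the source);
* `bond_symm h` becomes `hsy a ha b h` for the standing reciprocity hypothesis
  `hsy : ∀ x ∈ S, ∀ y ∈ shell S x, x ∈ shell S y`, inserted right after `hch` in
  `polar_at_lower_apex`, `onesided_at_lower_apex`, `VinvStep_spec` and passed on to
  `Istep_lower`, `Jstep_lower`, `IinvStep_lower`, `JinvStep_lower` (our `…TransportLower`),
  `transfer_nb_nb`, `transfer_nb_centre`;
* `(hch x hx).sqNormInt_eq ht` becomes `zchart_sqNormInt_eq (hch x hx) ht`;
* the three CHART-AGNOSTIC lemmas of the source part (`lowerCap_cases`, `isFrame_lowerCap`,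
  `cap_label_polar_or_fcc_lower`: pure pattern statements, no chart hypothesis) are NOT re-proved
  (the gate forbids restating landed declarations): they are used from the source module
  `…ShellsToBarlowChartTransportVinv`, imported for that purpose (as is `apexOf_eq_of_form` of the
  9227 part 6); since that import makes the 9227 parts 1–7, `Lower`, `Vinv` visible, the
  `open … hiding …` line of part 6 is EXTENDED by the chart-dependent 9227 names redeclared in our
  parts `Lower`, `Steps7` and here (`nb_inj`, `Istep_lower`, `Jstep_lower`, `IinvStep_lower`,
  `JinvStep_lower`, `Vstep_spec`, `polar_at_lower_apex`, `onesided_at_lower_apex`,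
  `VinvStep_spec`) — inside this namespace our declarations take precedence anyway;
* theorem names, docstrings and the order of all other hypotheses and conjuncts are those of the
  source;
* `transportVinv_anchor` (explicit-`∀` form of the first five conjuncts of `VinvStep_spec`: the
  `V⁻¹`-step lands at a labelled shell point of `x` that labels `x` back) is the registered anchor
  of this file.
-/

noncomputable section

namespace Summit.AtomisticToContinuum.Crystallization.Theorems.HullExactificationCascadeRobustBarlowTemplate

open Literature.Geometry.DiscreteGeometry Literature.MathematicalPhysics.StatisticalMechanics
open Summit.AtomisticToContinuum.Crystallization.Theorems.PalmUnimodularRigidityShellsToBarlowChart hiding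
  IsZChart TransportSystem scales_tied sqNormInt_transfer bond_symm nb_mem zlab_spec zlab_nb bond_nb_iff
  pattern_cases transfer_nb_nb transfer_nb_centre transfer_nb_target sqNormInt_zlab_centre hcp_of_mirror_pair
  Istep_spec Jstep_spec IinvStep_spec JinvStep_spec capWithAny_of_mem_cap IinvStep_Istep Istep_IinvStep
  JinvStep_Jstep Jstep_JinvStep polar_at_apex onesided_at_apex nb_inj Istep_lower Jstep_lower
  IinvStep_lower JinvStep_lower Vstep_spec polar_at_lower_apex onesided_at_lower_apex VinvStep_spec

variable {S : Set (EuclideanSpace ℝ (Fin 3))} {Pc : (EuclideanSpace ℝ (Fin 3)) → Finset (Fin 3 → ℤ)}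
  {Ac : (EuclideanSpace ℝ (Fin 3)) → ((EuclideanSpace ℝ (Fin 3)) →ₗᵢ[ℝ] (EuclideanSpace ℝ (Fin 3)))}
  {nb : (EuclideanSpace ℝ (Fin 3)) → (Fin 3 → ℤ) → (EuclideanSpace ℝ (Fin 3))}

/-- **Polarity at the lower apex** (mirror of `polar_at_apex`): a site attached to `x` through a
lower-cap label of a valid frame at `x`, if HCP, sees `x` as a polar label. [folklore] -/
theorem polar_at_lower_apex (hch : ∀ z ∈ S, IsZChart S z (Pc z) (Ac z) (nb z))
    (hsy : ∀ x ∈ S, ∀ y ∈ shell S x, x ∈ shell S y) {x : (EuclideanSpace ℝ (Fin 3))}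
    (hx : x ∈ S) {t₁ t₂ : Fin 3 → ℤ} {U : Finset (Fin 3 → ℤ)} (hU : IsFrame (Pc x) t₁ t₂ U)
    {c : Fin 3 → ℤ} (hcL : c ∈ lowerCap (Pc x) t₁ t₂ U) (hhcp : Pc (nb x c) = hcpInt) :
    -zlab Pc nb (nb x c) x ∉ Pc (nb x c) := by
  intro hneg
  have hcP : c ∈ Pc x := (mem_lowerCap_iff.1 hcL).1
  have hu := nb_mem hch hx hcP
  have hξ := zlab_spec hch hu.1 hx (hsy _ hx _ hu.2)
  have hξP : zlab Pc nb (nb x c) x ∈ hcpInt := by rw [← hhcp]; exact hξ.1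
  rw [hhcp] at hneg
  obtain ⟨m, hm, n, hn, hξm, hξn, hmn⟩ := exists_mirror_pair_of_equatorial _ hξP hneg
  have hmP : m ∈ Pc (nb x c) := by rw [hhcp]; exact hm
  have hnP : n ∈ Pc (nb x c) := by rw [hhcp]; exact hn
  have hzm := nb_mem hch hu.1 hmP
  have hzn := nb_mem hch hu.1 hnP
  have hbm : x ∈ shell S (nb (nb x c) m) := by
    have := (bond_nb_iff hch hu.1 hmP hξ.1).2 (by rw [sqNormInt_sub_comm]; exact hξm)
    rwa [hξ.2] at this
  have hbn : x ∈ shell S (nb (nb x c) n) := by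
    have := (bond_nb_iff hch hu.1 hnP hξ.1).2 (by rw [sqNormInt_sub_comm]; exact hξn)
    rwa [hξ.2] at this
  have ha := zlab_spec hch hx hzm.1 (hsy _ hzm.1 _ hbm)
  have hb := zlab_spec hch hx hzn.1 (hsy _ hzn.1 _ hbn)
  have hac : sqNormInt (zlab Pc nb x (nb (nb x c) m) - c) = 18 :=
    (bond_nb_iff hch hx ha.1 hcP).1 (by rw [ha.2]; exact hsy _ hu.1 _ hzm.2)
  have hbc : sqNormInt (zlab Pc nb x (nb (nb x c) n) - c) = 18 :=
    (bond_nb_iff hch hx hb.1 hcP).1 (by rw [hb.2]; exact hsy _ hu.1 _ hzn.2)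
  have htr := transfer_nb_nb hch hsy hx hu.1 hu.2 ha.1 hb.1 (by rw [ha.2]; exact hzm.2)
    (by rw [hb.2]; exact hzn.2)
  rw [ha.2, hb.2, zlab_nb hch hu.1 hmP, zlab_nb hch hu.1 hnP, hmn] at htr
  exact no_48_around_polar (Pc x) (pattern_cases hch hx) c hcP _ ha.1 _ hb.1
    (cap_label_polar_or_fcc_lower (pattern_cases hch hx) hU hcL)
    (by rw [sqNormInt_sub_comm]; exact hac) (by rw [sqNormInt_sub_comm]; exact hbc) htr.symm

/-- **One-sidedness at a common lower apex** (mirror of `onesided_at_apex`). [folklore] -/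
theorem onesided_at_lower_apex (hch : ∀ z ∈ S, IsZChart S z (Pc z) (Ac z) (nb z))
    (hsy : ∀ x ∈ S, ∀ y ∈ shell S x, x ∈ shell S y)
    {x x' : (EuclideanSpace ℝ (Fin 3))} (hx : x ∈ S) (hx' : x' ∈ S) {t₁ t₂ t₁' t₂' : Fin 3 → ℤ}
    {U U' : Finset (Fin 3 → ℤ)} (hU : IsFrame (Pc x) t₁ t₂ U) (hU' : IsFrame (Pc x') t₁' t₂' U')
    {c c' : Fin 3 → ℤ} (hcL : c ∈ lowerCap (Pc x) t₁ t₂ U)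
    (hcL' : c' ∈ lowerCap (Pc x') t₁' t₂' U') (heq : nb x c = nb x' c') :
    (-zlab Pc nb (nb x c) x ∈ Pc (nb x c) ∧ -zlab Pc nb (nb x c) x' ∈ Pc (nb x c)) ∨
      (-zlab Pc nb (nb x c) x ∉ Pc (nb x c) ∧ -zlab Pc nb (nb x c) x' ∉ Pc (nb x c)) := by
  have hcP : c ∈ Pc x := (mem_lowerCap_iff.1 hcL).1
  have hcP' : c' ∈ Pc x' := (mem_lowerCap_iff.1 hcL').1
  have hu := nb_mem hch hx hcP
  have hu' := nb_mem hch hx' hcP'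
  have hξ := zlab_spec hch hu.1 hx (hsy _ hx _ hu.2)
  have hξ' := zlab_spec hch hu.1 hx' (by rw [heq]; exact hsy _ hx' _ hu'.2)
  rcases pattern_cases hch hu.1 with hF | hH
  · left
    rw [hF] at hξ hξ' ⊢
    exact ⟨neg_mem_fcc3Int _ hξ.1, neg_mem_fcc3Int _ hξ'.1⟩
  · right
    refine ⟨polar_at_lower_apex hch hsy hx hU hcL hH, ?_⟩
    have := polar_at_lower_apex hch hsy hx' hU' hcL' (by rw [← heq]; exact hH)
    rwa [← heq] at this

/-- **The V⁻¹-step** (mirror of `Vstep_spec`).  For a valid frame `g = ⟨x, t₁, t₂, U⟩` whose four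
in-layer transports are valid frames, `VinvStep g` lands at the lower apex site `d = nb x c'`
(`c'` the apex of the lower cap `L`), is a valid frame of parity `lowerParity t₁ t₂ L` (the
letter below `x`), and its upper cap consists of the labels at `d` of `x` and of the two in-layer
neighbours of `x` above `d` (`nb x (∓t₁), nb x (∓t₂)`, sign = that letter). [folklore] -/
theorem VinvStep_spec (hch : ∀ z ∈ S, IsZChart S z (Pc z) (Ac z) (nb z))
    (hsy : ∀ x ∈ S, ∀ y ∈ shell S x, x ∈ shell S y) {x : (EuclideanSpace ℝ (Fin 3))}
    (hx : x ∈ S) {t₁ t₂ : Fin 3 → ℤ} {U : Finset (Fin 3 → ℤ)} (hU : IsFrame (Pc x) t₁ t₂ U)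
    (hI : IsFrame (Pc (nb x t₁)) (Istep Pc nb ⟨x, t₁, t₂, U⟩).t₁ (Istep Pc nb ⟨x, t₁, t₂, U⟩).t₂
      (Istep Pc nb ⟨x, t₁, t₂, U⟩).U)
    (hJ : IsFrame (Pc (nb x t₂)) (Jstep Pc nb ⟨x, t₁, t₂, U⟩).t₁ (Jstep Pc nb ⟨x, t₁, t₂, U⟩).t₂
      (Jstep Pc nb ⟨x, t₁, t₂, U⟩).U)
    (hIi : IsFrame (Pc (nb x (-t₁))) (IinvStep Pc nb ⟨x, t₁, t₂, U⟩).t₁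
      (IinvStep Pc nb ⟨x, t₁, t₂, U⟩).t₂ (IinvStep Pc nb ⟨x, t₁, t₂, U⟩).U)
    (hJi : IsFrame (Pc (nb x (-t₂))) (JinvStep Pc nb ⟨x, t₁, t₂, U⟩).t₁
      (JinvStep Pc nb ⟨x, t₁, t₂, U⟩).t₂ (JinvStep Pc nb ⟨x, t₁, t₂, U⟩).U) :
    apexOf t₁ t₂ (lowerCap (Pc x) t₁ t₂ U) ∈ lowerCap (Pc x) t₁ t₂ U ∧
    nb x (apexOf t₁ t₂ (lowerCap (Pc x) t₁ t₂ U)) ∈ S ∧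
    nb x (apexOf t₁ t₂ (lowerCap (Pc x) t₁ t₂ U)) ∈ shell S x ∧
    zlab Pc nb (nb x (apexOf t₁ t₂ (lowerCap (Pc x) t₁ t₂ U))) x ∈
      Pc (nb x (apexOf t₁ t₂ (lowerCap (Pc x) t₁ t₂ U))) ∧
    nb (nb x (apexOf t₁ t₂ (lowerCap (Pc x) t₁ t₂ U)))
      (zlab Pc nb (nb x (apexOf t₁ t₂ (lowerCap (Pc x) t₁ t₂ U))) x) = x ∧
    IsFrame (Pc (nb x (apexOf t₁ t₂ (lowerCap (Pc x) t₁ t₂ U)))) (VinvStep Pc nb ⟨x, t₁, t₂, U⟩).t₁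
      (VinvStep Pc nb ⟨x, t₁, t₂, U⟩).t₂ (VinvStep Pc nb ⟨x, t₁, t₂, U⟩).U ∧
    frameParity (VinvStep Pc nb ⟨x, t₁, t₂, U⟩).t₁ (VinvStep Pc nb ⟨x, t₁, t₂, U⟩).t₂
        (VinvStep Pc nb ⟨x, t₁, t₂, U⟩).U = lowerParity t₁ t₂ (lowerCap (Pc x) t₁ t₂ U) ∧
    ((lowerParity t₁ t₂ (lowerCap (Pc x) t₁ t₂ U) = 1 ∧
      (VinvStep Pc nb ⟨x, t₁, t₂, U⟩).U =
        {zlab Pc nb (nb x (apexOf t₁ t₂ (lowerCap (Pc x) t₁ t₂ U))) x,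
          zlab Pc nb (nb x (apexOf t₁ t₂ (lowerCap (Pc x) t₁ t₂ U))) x - (VinvStep Pc nb ⟨x, t₁, t₂, U⟩).t₁,
          zlab Pc nb (nb x (apexOf t₁ t₂ (lowerCap (Pc x) t₁ t₂ U))) x - (VinvStep Pc nb ⟨x, t₁, t₂, U⟩).t₂} ∧
      nb (nb x (apexOf t₁ t₂ (lowerCap (Pc x) t₁ t₂ U)))
          (zlab Pc nb (nb x (apexOf t₁ t₂ (lowerCap (Pc x) t₁ t₂ U))) x -
            (VinvStep Pc nb ⟨x, t₁, t₂, U⟩).t₁) = nb x (-t₁) ∧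
      nb (nb x (apexOf t₁ t₂ (lowerCap (Pc x) t₁ t₂ U)))
          (zlab Pc nb (nb x (apexOf t₁ t₂ (lowerCap (Pc x) t₁ t₂ U))) x -
            (VinvStep Pc nb ⟨x, t₁, t₂, U⟩).t₂) = nb x (-t₂) ∧
      lowerCap (Pc x) t₁ t₂ U = {apexOf t₁ t₂ (lowerCap (Pc x) t₁ t₂ U),
        apexOf t₁ t₂ (lowerCap (Pc x) t₁ t₂ U) + t₁, apexOf t₁ t₂ (lowerCap (Pc x) t₁ t₂ U) + t₂}) ∨
     (lowerParity t₁ t₂ (lowerCap (Pc x) t₁ t₂ U) = -1 ∧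
      (VinvStep Pc nb ⟨x, t₁, t₂, U⟩).U =
        {zlab Pc nb (nb x (apexOf t₁ t₂ (lowerCap (Pc x) t₁ t₂ U))) x,
          zlab Pc nb (nb x (apexOf t₁ t₂ (lowerCap (Pc x) t₁ t₂ U))) x + (VinvStep Pc nb ⟨x, t₁, t₂, U⟩).t₁,
          zlab Pc nb (nb x (apexOf t₁ t₂ (lowerCap (Pc x) t₁ t₂ U))) x + (VinvStep Pc nb ⟨x, t₁, t₂, U⟩).t₂} ∧
      nb (nb x (apexOf t₁ t₂ (lowerCap (Pc x) t₁ t₂ U)))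
          (zlab Pc nb (nb x (apexOf t₁ t₂ (lowerCap (Pc x) t₁ t₂ U))) x +
            (VinvStep Pc nb ⟨x, t₁, t₂, U⟩).t₁) = nb x t₁ ∧
      nb (nb x (apexOf t₁ t₂ (lowerCap (Pc x) t₁ t₂ U)))
          (zlab Pc nb (nb x (apexOf t₁ t₂ (lowerCap (Pc x) t₁ t₂ U))) x +
            (VinvStep Pc nb ⟨x, t₁, t₂, U⟩).t₂) = nb x t₂ ∧
      lowerCap (Pc x) t₁ t₂ U = {apexOf t₁ t₂ (lowerCap (Pc x) t₁ t₂ U),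
        apexOf t₁ t₂ (lowerCap (Pc x) t₁ t₂ U) - t₁, apexOf t₁ t₂ (lowerCap (Pc x) t₁ t₂ U) - t₂})) := by
  obtain ⟨h12, hhex, hUP, hoff, c, hcU, hform⟩ := id hU
  have hPx := pattern_cases hch hx
  have ht₁ : t₁ ∈ Pc x := hhex (mem_hexLabels_iff.2 (Or.inl rfl))
  have ht₂ : t₂ ∈ Pc x := hhex (mem_hexLabels_iff.2 (Or.inr (Or.inl rfl)))
  have hnt₁ : -t₁ ∈ Pc x := hhex (mem_hexLabels_iff.2 (Or.inr (Or.inr (Or.inr (Or.inl rfl)))))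
  have hnt₂ : -t₂ ∈ Pc x :=
    hhex (mem_hexLabels_iff.2 (Or.inr (Or.inr (Or.inr (Or.inr (Or.inl rfl))))))
  obtain ⟨d', hd'L, hd'P, hd'hex, hLcase⟩ := lowerCap_cases hPx hU
  have hLframe : IsFrame (Pc x) t₁ t₂ (lowerCap (Pc x) t₁ t₂ U) := isFrame_lowerCap hPx hU
  have hapexL : apexOf t₁ t₂ (lowerCap (Pc x) t₁ t₂ U) = d' := by
    rcases hLcase with ⟨hLeq, -, -, -⟩ | ⟨hLeq, -, -, -⟩
    · exact apexOf_eq_of_form hPx hLframe hd'L (Or.inr hLeq)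
    · exact apexOf_eq_of_form hPx hLframe hd'L (Or.inl hLeq)
  rw [hapexL]
  have hu := nb_mem hch hx hd'P
  have hPd := pattern_cases hch hu.1
  have hξ := zlab_spec hch hu.1 hx (hsy _ hx _ hu.2)
  set ξ := zlab Pc nb (nb x d') x with hξ_def
  have hyS : nb x t₁ ∈ S := (nb_mem hch hx ht₁).1
  have hy'S : nb x t₂ ∈ S := (nb_mem hch hx ht₂).1
  have hymS : nb x (-t₁) ∈ S := (nb_mem hch hx hnt₁).1
  have hym'S : nb x (-t₂) ∈ S := (nb_mem hch hx hnt₂).1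
  rcases hLcase with ⟨hLeq, hlp, hd1, hd2⟩ | ⟨hLeq, hlp, hd1, hd2⟩
  · /- letter below `+1`: `L = {d', d' + t₁, d' + t₂}`; the upper sites of `d` are `x, I⁻¹x, J⁻¹x` -/
    have hdx := dist_oddCap (Pc x) hPx t₁ ht₁ t₂ ht₂ d' hd'P h12 hhex hd'hex hd1 hd2
    have hbI : nb x (-t₁) ∈ shell S (nb x d') :=
      (bond_nb_iff hch hx hd'P hnt₁).2 (by rw [sqNormInt_sub_comm]; exact hdx.1)
    have hbJ : nb x (-t₂) ∈ shell S (nb x d') :=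
      (bond_nb_iff hch hx hd'P hnt₂).2 (by rw [sqNormInt_sub_comm]; exact hdx.2.1)
    have hη := zlab_spec hch hu.1 hymS hbI
    have hζ := zlab_spec hch hu.1 hym'S hbJ
    set η := zlab Pc nb (nb x d') (nb x (-t₁)) with hη_def
    set ζ := zlab Pc nb (nb x d') (nb x (-t₂)) with hζ_def
    have Dηξ : sqNormInt (η - ξ) = 18 := by
      rw [hη_def, hξ_def, transfer_nb_centre hch hsy hx hu.1 hu.2 hnt₁ hbI, sqNormInt_neg]
      exact zchart_sqNormInt_eq (hch x hx) ht₁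
    have Dζξ : sqNormInt (ζ - ξ) = 18 := by
      rw [hζ_def, hξ_def, transfer_nb_centre hch hsy hx hu.1 hu.2 hnt₂ hbJ, sqNormInt_neg]
      exact zchart_sqNormInt_eq (hch x hx) ht₂
    have Dηζ : sqNormInt (η - ζ) = 18 := by
      rw [hη_def, hζ_def, transfer_nb_nb hch hsy hx hu.1 hu.2 hnt₁ hnt₂ hbI hbJ,
        show -t₁ - -t₂ = t₂ - t₁ by abel, sqNormInt_sub_comm]
      exact h12
    -- `d` is attached to `I⁻¹x` and `J⁻¹x` through their LOWER caps
    have hregI : Pc (nb x (-t₁)) = fcc3Int ∨ Pc x = hcpInt ∨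
        (-zlab Pc nb (nb x (-t₁)) x ∈ Pc (nb x (-t₁)) ∧
          -zlab Pc nb (nb x (-t₁)) (nb x (t₂ - t₁)) ∈ Pc (nb x (-t₁))) :=
      Or.inr (Or.inr ⟨hIi.2.1 (mem_hexLabels_iff.2 (Or.inr (Or.inr (Or.inr (Or.inl rfl))))),
        hIi.2.1 (mem_hexLabels_iff.2 (Or.inr (Or.inr (Or.inr (Or.inr (Or.inl rfl))))))⟩)
    have hregJ : Pc (nb x (-t₂)) = fcc3Int ∨ Pc x = hcpInt ∨
        (-zlab Pc nb (nb x (-t₂)) x ∈ Pc (nb x (-t₂)) ∧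
          -zlab Pc nb (nb x (-t₂)) (nb x (t₁ - t₂)) ∈ Pc (nb x (-t₂))) :=
      Or.inr (Or.inr ⟨hJi.2.1 (mem_hexLabels_iff.2 (Or.inr (Or.inr (Or.inr (Or.inr (Or.inl rfl)))))),
        hJi.2.1 (mem_hexLabels_iff.2 (Or.inr (Or.inr (Or.inr (Or.inl rfl)))))⟩)
    obtain ⟨ℓ₁, -, -, hfiltI, hbu₁, -, hlamL₁⟩ := IinvStep_lower hch hsy hx hU hregI
    obtain ⟨ℓ₂, -, -, hfiltJ, hbu₂, -, hlamL₂⟩ := JinvStep_lower hch hsy hx hU hregJ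
    have hfx := filter_oddCap (Pc x) hPx t₁ ht₁ t₂ ht₂ d' hd'P h12 hhex hd'hex hd1 hd2
    have hℓ₁ : ℓ₁ = d' := by
      have h1 := hfx.2.2.1
      rw [← hLeq, hfiltI] at h1
      exact Finset.singleton_injective h1
    have hℓ₂ : ℓ₂ = d' := by
      have h1 := hfx.2.2.2
      rw [← hLeq, hfiltJ] at h1
      exact Finset.singleton_injective h1
    rw [hℓ₁] at hbu₁ hlamL₁
    rw [hℓ₂] at hbu₂ hlamL₂
    have hμ₁ := zlab_spec hch hymS hu.1 hbu₁
    have hμ₂ := zlab_spec hch hym'S hu.1 hbu₂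
    have hos1 := onesided_at_lower_apex hch hsy hx hymS hU hIi hd'L hlamL₁ hμ₁.2.symm
    have hos2 := onesided_at_lower_apex hch hsy hx hym'S hU hJi hd'L hlamL₂ hμ₂.2.symm
    have hos : (-ξ ∈ Pc (nb x d') ∧ -η ∈ Pc (nb x d') ∧ -ζ ∈ Pc (nb x d')) ∨
        (-ξ ∉ Pc (nb x d') ∧ -η ∉ Pc (nb x d') ∧ -ζ ∉ Pc (nb x d')) := by
      rcases hos1 with ⟨a1, a2⟩ | ⟨a1, a2⟩ <;> rcases hos2 with ⟨b1, b2⟩ | ⟨b1, b2⟩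
      · exact Or.inl ⟨a1, a2, b2⟩
      · exact (b1 a1).elim
      · exact (a1 b1).elim
      · exact Or.inr ⟨a1, a2, b2⟩
    obtain ⟨hframeU, hcapeq, hparU⟩ := isFrame_capWith_even (Pc (nb x d')) hPd ξ hξ.1 η hη.1 ζ hζ.1
      (by rw [sqNormInt_sub_comm]; exact Dηξ) (by rw [sqNormInt_sub_comm]; exact Dζξ) Dηζ hos
    have hV : VinvStep Pc nb ⟨x, t₁, t₂, U⟩ =
        ⟨nb x d', ξ - η, ξ - ζ, capWith (Pc (nb x d')) (ξ - η) (ξ - ζ) ξ⟩ := by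
      simp only [VinvStep, hapexL, if_pos hlp]
      try rfl
    rw [hV]
    refine ⟨hd'L, hu.1, hu.2, hξ.1, hξ.2, hframeU, ?_, Or.inl ⟨hlp, ?_, ?_, ?_, hLeq⟩⟩
    · show frameParity (ξ - η) (ξ - ζ) (capWith (Pc (nb x d')) (ξ - η) (ξ - ζ) ξ) =
        lowerParity t₁ t₂ (lowerCap (Pc x) t₁ t₂ U)
      rw [hlp]; exact hparU
    · show capWith (Pc (nb x d')) (ξ - η) (ξ - ζ) ξ = {ξ, ξ - (ξ - η), ξ - (ξ - ζ)}
      rw [hcapeq, sub_sub_cancel, sub_sub_cancel]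
    · show nb (nb x d') (ξ - (ξ - η)) = nb x (-t₁)
      rw [sub_sub_cancel]; exact hη.2
    · show nb (nb x d') (ξ - (ξ - ζ)) = nb x (-t₂)
      rw [sub_sub_cancel]; exact hζ.2
  · /- letter below `−1`: `L = {d', d' − t₁, d' − t₂}`; the upper sites of `d` are `x, Ix, Jx` -/
    have hdx := dist_evenCap (Pc x) hPx t₁ ht₁ t₂ ht₂ d' hd'P h12 hhex hd'hex hd1 hd2
    have hbI : nb x t₁ ∈ shell S (nb x d') :=
      (bond_nb_iff hch hx hd'P ht₁).2 (by rw [sqNormInt_sub_comm]; exact hdx.2.1)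
    have hbJ : nb x t₂ ∈ shell S (nb x d') :=
      (bond_nb_iff hch hx hd'P ht₂).2 (by rw [sqNormInt_sub_comm]; exact hdx.1)
    have hη := zlab_spec hch hu.1 hyS hbI
    have hζ := zlab_spec hch hu.1 hy'S hbJ
    set η := zlab Pc nb (nb x d') (nb x t₁) with hη_def
    set ζ := zlab Pc nb (nb x d') (nb x t₂) with hζ_def
    have Dηξ : sqNormInt (η - ξ) = 18 := by
      rw [hη_def, hξ_def, transfer_nb_centre hch hsy hx hu.1 hu.2 ht₁ hbI]
      exact zchart_sqNormInt_eq (hch x hx) ht₁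
    have Dζξ : sqNormInt (ζ - ξ) = 18 := by
      rw [hζ_def, hξ_def, transfer_nb_centre hch hsy hx hu.1 hu.2 ht₂ hbJ]
      exact zchart_sqNormInt_eq (hch x hx) ht₂
    have Dηζ : sqNormInt (η - ζ) = 18 := by
      rw [hη_def, hζ_def, transfer_nb_nb hch hsy hx hu.1 hu.2 ht₁ ht₂ hbI hbJ]; exact h12
    have hregI : Pc (nb x t₁) = fcc3Int ∨ Pc x = hcpInt ∨
        (-zlab Pc nb (nb x t₁) x ∈ Pc (nb x t₁) ∧ -zlab Pc nb (nb x t₁) (nb x t₂) ∈ Pc (nb x t₁)) := by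
      refine Or.inr (Or.inr ⟨hI.2.1 (mem_hexLabels_iff.2 (Or.inl rfl)), ?_⟩)
      have h6 := hI.2.1 (mem_hexLabels_iff.2 (Or.inr (Or.inr (Or.inr (Or.inr (Or.inr rfl))))))
      have e : (Istep Pc nb ⟨x, t₁, t₂, U⟩).t₁ - (Istep Pc nb ⟨x, t₁, t₂, U⟩).t₂ =
          -zlab Pc nb (nb x t₁) (nb x t₂) := by
        show -zlab Pc nb (nb x t₁) x - (zlab Pc nb (nb x t₁) (nb x t₂) - zlab Pc nb (nb x t₁) x) = _
        abel
      rwa [e] at h6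
    have hregJ : Pc (nb x t₂) = fcc3Int ∨ Pc x = hcpInt ∨
        (-zlab Pc nb (nb x t₂) x ∈ Pc (nb x t₂) ∧ -zlab Pc nb (nb x t₂) (nb x t₁) ∈ Pc (nb x t₂)) := by
      refine Or.inr (Or.inr ⟨hJ.2.1 (mem_hexLabels_iff.2 (Or.inr (Or.inl rfl))), ?_⟩)
      have h3 := hJ.2.1 (mem_hexLabels_iff.2 (Or.inr (Or.inr (Or.inl rfl))))
      have e : (Jstep Pc nb ⟨x, t₁, t₂, U⟩).t₂ - (Jstep Pc nb ⟨x, t₁, t₂, U⟩).t₁ =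
          -zlab Pc nb (nb x t₂) (nb x t₁) := by
        show -zlab Pc nb (nb x t₂) x - (zlab Pc nb (nb x t₂) (nb x t₁) - zlab Pc nb (nb x t₂) x) = _
        abel
      rwa [e] at h3
    obtain ⟨ℓ₁, -, -, hfiltI, hbu₁, -, hlamL₁⟩ := Istep_lower hch hsy hx hU hregI
    obtain ⟨ℓ₂, -, -, hfiltJ, hbu₂, -, hlamL₂⟩ := Jstep_lower hch hsy hx hU hregJ
    have hfx := filter_evenCap (Pc x) hPx t₁ ht₁ t₂ ht₂ d' hd'P h12 hhex hd'hex hd1 hd2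
    have hℓ₁ : ℓ₁ = d' := by
      have h1 := hfx.1
      rw [← hLeq, hfiltI] at h1
      exact Finset.singleton_injective h1
    have hℓ₂ : ℓ₂ = d' := by
      have h1 := hfx.2.1
      rw [← hLeq, hfiltJ] at h1
      exact Finset.singleton_injective h1
    rw [hℓ₁] at hbu₁ hlamL₁
    rw [hℓ₂] at hbu₂ hlamL₂
    have hμ₁ := zlab_spec hch hyS hu.1 hbu₁
    have hμ₂ := zlab_spec hch hy'S hu.1 hbu₂
    have hos1 := onesided_at_lower_apex hch hsy hx hyS hU hI hd'L hlamL₁ hμ₁.2.symm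
    have hos2 := onesided_at_lower_apex hch hsy hx hy'S hU hJ hd'L hlamL₂ hμ₂.2.symm
    have hos : (-ξ ∈ Pc (nb x d') ∧ -η ∈ Pc (nb x d') ∧ -ζ ∈ Pc (nb x d')) ∨
        (-ξ ∉ Pc (nb x d') ∧ -η ∉ Pc (nb x d') ∧ -ζ ∉ Pc (nb x d')) := by
      rcases hos1 with ⟨a1, a2⟩ | ⟨a1, a2⟩ <;> rcases hos2 with ⟨b1, b2⟩ | ⟨b1, b2⟩
      · exact Or.inl ⟨a1, a2, b2⟩
      · exact (b1 a1).elim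
      · exact (a1 b1).elim
      · exact Or.inr ⟨a1, a2, b2⟩
    obtain ⟨hframeU, hcapeq, hparU⟩ := isFrame_capWith_odd (Pc (nb x d')) hPd ξ hξ.1 η hη.1 ζ hζ.1
      (by rw [sqNormInt_sub_comm]; exact Dηξ) (by rw [sqNormInt_sub_comm]; exact Dζξ) Dηζ hos
    have hne : ¬ lowerParity t₁ t₂ (lowerCap (Pc x) t₁ t₂ U) = 1 := by rw [hlp]; norm_num
    have hV : VinvStep Pc nb ⟨x, t₁, t₂, U⟩ =
        ⟨nb x d', η - ξ, ζ - ξ, capWith (Pc (nb x d')) (η - ξ) (ζ - ξ) ξ⟩ := by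
      simp only [VinvStep, hapexL, if_neg hne]
      try rfl
    rw [hV]
    refine ⟨hd'L, hu.1, hu.2, hξ.1, hξ.2, hframeU, ?_, Or.inr ⟨hlp, ?_, ?_, ?_, hLeq⟩⟩
    · show frameParity (η - ξ) (ζ - ξ) (capWith (Pc (nb x d')) (η - ξ) (ζ - ξ) ξ) =
        lowerParity t₁ t₂ (lowerCap (Pc x) t₁ t₂ U)
      rw [hlp]; exact hparU
    · show capWith (Pc (nb x d')) (η - ξ) (ζ - ξ) ξ = {ξ, ξ + (η - ξ), ξ + (ζ - ξ)}
      rw [hcapeq, show ξ + (η - ξ) = η by abel, show ξ + (ζ - ξ) = ζ by abel]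
    · show nb (nb x d') (ξ + (η - ξ)) = nb x t₁
      rw [show ξ + (η - ξ) = η by abel]; exact hη.2
    · show nb (nb x d') (ξ + (ζ - ξ)) = nb x t₂
      rw [show ξ + (ζ - ξ) = ζ by abel]; exact hζ.2

/-! ## Anchor -/

/-- Anchor (registered sub-goal of stmt-AtomisticToContinuum-12088, toward `develop_transport`):
for a valid frame whose four in-layer transports are valid frames, the `V⁻¹`-step lands at the
labelled shell point `nb x (apexOf t₁ t₂ (lowerCap (Pc x) t₁ t₂ U))` of `x`, whose chart labels `x`
back (the first five conjuncts of `VinvStep_spec`, explicit form). [folklore] -/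
theorem transportVinv_anchor : ∀ (S : Set (EuclideanSpace ℝ (Fin 3))) (Pc : EuclideanSpace ℝ (Fin 3) → Finset (Fin 3 → ℤ)) (Ac : EuclideanSpace ℝ (Fin 3) → (EuclideanSpace ℝ (Fin 3) →ₗᵢ[ℝ] EuclideanSpace ℝ (Fin 3))) (nb : EuclideanSpace ℝ (Fin 3) → (Fin 3 → ℤ) → EuclideanSpace ℝ (Fin 3)), (∀ z ∈ S, IsZChart S z (Pc z) (Ac z) (nb z)) → (∀ x ∈ S, ∀ y ∈ shell S x, x ∈ shell S y) → ∀ x ∈ S, ∀ (t₁ t₂ : Fin 3 → ℤ) (U : Finset (Fin 3 → ℤ)), IsFrame (Pc x) t₁ t₂ U → IsFrame (Pc (nb x t₁)) (Istep Pc nb ⟨x, t₁, t₂, U⟩).t₁ (Istep Pc nb ⟨x, t₁, t₂, U⟩).t₂ (Istep Pc nb ⟨x, t₁, t₂, U⟩).U → IsFrame (Pc (nb x t₂)) (Jstep Pc nb ⟨x, t₁, t₂, U⟩).t₁ (Jstep Pc nb ⟨x, t₁, t₂, U⟩).t₂ (Jstep Pc nb ⟨x, t₁, t₂, U⟩).U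 → IsFrame (Pc (nb x (-t₁))) (IinvStep Pc nb ⟨x, t₁, t₂, U⟩).t₁ (IinvStep Pc nb ⟨x, t₁, t₂, U⟩).t₂ (IinvStep Pc nb ⟨x, t₁, t₂, U⟩).U → IsFrame (Pc (nb x (-t₂))) (JinvStep Pc nb ⟨x, t₁, t₂, U⟩).t₁ (JinvStep Pc nb ⟨x, t₁, t₂, U⟩).t₂ (JinvStep Pc nb ⟨x, t₁, t₂, U⟩).U → apexOf t₁ t₂ (lowerCap (Pc x) t₁ t₂ U) ∈ lowerCap (Pc x) t₁ t₂ U ∧ nb x (apexOf t₁ t₂ (lowerCap (Pc x) t₁ t₂ U)) ∈ S ∧ nb x (apexOf t₁ t₂ (lowerCap (Pc x) t₁ t₂ U)) ∈ shell S x ∧ zlab Pc nb (nb x (apexOf t₁ t₂ (lowerCap (Pc x) t₁ t₂ U))) x ∈ Pc (nb x (apexOf t₁ t₂ (lowerCap (Pc x) t₁ t₂ U))) ∧ nb (nb x (apexOf t₁ t₂ (lowerCap (Pc x) t₁ t₂ U))) (zlab Pc nb (nb x (apexOf t₁ t₂ (lowerCap (Pc x) t₁ t₂ U))) x) = x :=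
  fun _ _ _ _ hch hsy _ hx _ _ _ hU hI hJ hIi hJi =>
    let h := VinvStep_spec hch hsy hx hU hI hJ hIi hJi
    ⟨h.1, h.2.1, h.2.2.1, h.2.2.2.1, h.2.2.2.2.1⟩

end Summit.AtomisticToContinuum.Crystallization.Theorems.HullExactificationCascadeRobustBarlowTemplate

end
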